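import Summits.HodgeConjecture.HodgeConjecture.Theorems.MarkmanPartnerTransportPicardThreeK3SquaresZeta11Type
import Summits.HodgeConjecture.HodgeConjecture.Theorems.MarkmanPartnerTransportPartnerTransport
import HarnessLib

/-!
# Route MarkmanPartnerTransport · crux #5 `LowPicardRealMultiplication` (stmt-HodgeConjecture-19653) —
# cell (3,5) on the `X` side, pointwise: HC⁴(X) for every `K3^{[2]}`-type fourfold whose K3 partner is of
# the ζ₁₁ real-multiplication type

Cell hodge-nonav; prover seat hodge-nonav-19652-p1 (gen 11); `--supports stmt-HodgeConjecture-19653`, helper.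
Composition of `RMTypeOrbit.hodgeConjectureFor_square_of_zeta11Type` (`…PicardThreeK3SquaresZeta11Type`:
HC⁴(S ⊗ S) for every marked projective K3 surface `S` whose RM generator is conjugate by a rational
isometry to the ζ₁₁ model `θ(g)` of the van Geemen–Schütt family, mod {Buskin, the vGS/Oguiso–Zhang
open-set fact}) with support #2 `PartnerTransport` (`PartnerLattice.partnerTransport_explicit`, gen 6:
Beauville's marked Hilbert square, blow-up + surjective descent, Witt extension, Markman's algebraic lift;
mod {Beauville ×2, Markman 2024, Voisin cup}). For the members (`ρ(S) = 2`, `E = ℚ(ζ₁₁ + ζ₁₁⁻¹)`,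
`[E:ℚ] = 5`) the partners have `ρ(X) = 3`: cell `(3,5)` of the crux. A separate (leaf) file because
`…PartnerTransport` imports the route file. CONDITIONAL on the six displayed named facts ONLY; credits
nothing; neither the crux nor HC is proved here. No definition, no sorry.

References: van Geemen–Schütt, Forum Math. Sigma 13 (2025) e2, Thm. 1.1 (11), §4.8, §5.8; Oguiso–Zhang,
Pure Appl. Math. Q. 7 (2011), Thm. 1.5; E. Markman, Compos. Math. 160 (2024) Thm. 1.1, 1.4; A. Beauville,
J. Differential Geom. 18 (1983) §6; N. Buskin, J. reine angew. Math. 755 (2019) Thm. 1.1.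
-/

set_option linter.dupNamespace false

noncomputable section

namespace Summit.HodgeConjecture.HodgeConjecture.Theorems.MarkmanPartnerTransport.RMTypeOrbit

open CategoryTheory MonoidalCategory Polynomial
open Literature.AlgebraicGeometry Literature.AlgebraicGeometry.Motives Literature.AlgebraicGeometry.HodgeTheory
open Literature.AlgebraicGeometry.Surfaces Literature.LinearAlgebra.QuadraticForm
open Literature.AlgebraicGeometry.Hyperkaehler Literature.AlgebraicGeometry.HilbertScheme
open Literature.AlgebraicTopology.SingularHomology Literature.Geometry.Kaehler
open Summit.HodgeConjecture.HodgeConjecture.Theorems.NikulinTwinTransport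
open Summit.HodgeConjecture.HodgeConjecture.Theorems.MarkmanPartnerTransport.IsogenyInvariance
open Summit.HodgeConjecture.HodgeConjecture.Theorems.MarkmanPartnerTransport.RMTypeDescent

/-- `MarkedK3[S, η, p, x]`: VERBATIM the `let MarkedK3 := …` binder of the route declaration
`PicardThreeK3Squares` (as in `…RMTypeDescent`). Local notation only. -/
local notation3 (prettyPrint := false) "MarkedK3[" S ", " η ", " p ", " x "]" =>
  (p ≠ 0 ∧ (IsIntegralClass p ∧
    (∀ q : complexBetti S (2 * 2), IsIntegralClass q → ∃ n : ℤ, q = n • p) ∧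
    (∀ c : complexBetti S (2 * 1), IsIntegralClass c ↔ ∃ v : K3Index → ℤ, η c = fun i => (v i : ℂ)) ∧
    (∀ a b : complexBetti S (2 * 1),
      cupProduct (rfl : 2 * 1 + 2 * 1 = 2 * 2) a b = k3Form (η a) (η b) • p) ∧
    IsOfHodgeType 2 S (2 * 1) 2 0 (LinearEquiv.symm η x) ∧
    (∀ τ : complexBetti S (2 * 1), IsOfHodgeType 2 S (2 * 1) 2 0 τ →
      ∃ t : ℂ, τ = t • LinearEquiv.symm η x)) ∧
    (k3Form x x = 0 ∧ 0 < (k3Form (star x) x).re ∧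
      ∃ u : K3Index → ℤ, k3Form (fun i => (u i : ℂ)) x = 0 ∧ 0 < ∑ i, ∑ j, u i * k3Gram i j * u j))

/-- `Zeta11Model[g, u₁, u₂, y₀, θ]`: VERBATIM the antecedents of the named fact
`VanGeemenSchuett2025_OguisoZhang2011_zeta11_cycleOnOpenPeriodSet` — `g` is an integral
`k3Form`-isometry of `Λ_ℂ` of order `11` with invariant lattice the hyperbolic plane `ℤu₁ ⊕ ℤu₂ ≅ U`,
`y₀` is a period point in its `ζ₁₁ = e^{2πi/11}`-eigenspace, and `θ ∈ M₂₂(ℚ)` is the model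
real-multiplication endomorphism: `θ_ℂ = (g + g¹⁰) - 2π_U`. Local notation only. -/
local notation3 (prettyPrint := false) "Zeta11Model[" g ", " u₁ ", " u₂ ", " y₀ ", " θ "]" =>
  ((∀ a b : K3Index → ℂ, k3Form (g a) (g b) = k3Form a b) ∧
    (∀ v : K3Index → ℤ, ∃ w : K3Index → ℤ,
      g (fun i => ((v i : ℤ) : ℂ)) = fun i => ((w i : ℤ) : ℂ)) ∧
    g ^ 11 = 1 ∧
    g (fun i => ((u₁ i : ℤ) : ℂ)) = (fun i => ((u₁ i : ℤ) : ℂ)) ∧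
    g (fun i => ((u₂ i : ℤ) : ℂ)) = (fun i => ((u₂ i : ℤ) : ℂ)) ∧
    k3Form (fun i => ((u₁ i : ℤ) : ℂ)) (fun i => ((u₁ i : ℤ) : ℂ)) = 0 ∧
    k3Form (fun i => ((u₂ i : ℤ) : ℂ)) (fun i => ((u₂ i : ℤ) : ℂ)) = 0 ∧
    k3Form (fun i => ((u₁ i : ℤ) : ℂ)) (fun i => ((u₂ i : ℤ) : ℂ)) = 1 ∧
    (∀ v : K3Index → ℤ, g (fun i => ((v i : ℤ) : ℂ)) = (fun i => ((v i : ℤ) : ℂ)) →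
      ∃ m n : ℤ, v = m • u₁ + n • u₂) ∧
    k3Form y₀ y₀ = 0 ∧ 0 < (k3Form (star y₀) y₀).re ∧
    g y₀ = Complex.exp (2 * Real.pi * Complex.I / 11) • y₀ ∧
    (∀ y : K3Index → ℂ, thetaC θ y =
      g y + (g ^ 10) y - (2 * k3Form y (fun i => ((u₂ i : ℤ) : ℂ))) • (fun i => ((u₁ i : ℤ) : ℂ))
        - (2 * k3Form y (fun i => ((u₁ i : ℤ) : ℂ))) • (fun i => ((u₂ i : ℤ) : ℂ))))

/-- `MarkedK3Sq[X, φ, P, z]`: VERBATIM the `let MarkedK3Sq := …` binder of the route declarations of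
MarkmanPartnerTransport (clauses (m1)–(m6)), as in `…PartnerTransport`. Local notation only. -/
local notation3 (prettyPrint := false) "MarkedK3Sq[" X ", " φ ", " P ", " z "]" =>
  (((IsIntegralClass P ∧ ∀ Q : complexBetti X (2 * 4), IsIntegralClass Q → ∃ n : ℤ, Q = n • P) ∧
    (∀ c : complexBetti X 2, IsIntegralClass c ↔ ∃ v : K3HilbertIndex → ℤ, φ c = fun i => (v i : ℂ)) ∧
    (∀ a : complexBetti X 2, cupPowTwo a 4 = ((3 : ℂ) * (k3HilbertForm 2 (φ a) (φ a)) ^ 2) • P) ∧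
    (IsOfHodgeType 4 X 2 2 0 (LinearEquiv.symm φ z) ∧
      ∀ τ : complexBetti X 2, IsOfHodgeType 4 X 2 2 0 τ → ∃ t : ℂ, τ = t • LinearEquiv.symm φ z) ∧
    (∀ c : complexBetti X 2, IsOfHodgeType 4 X 2 1 1 c ↔
      (k3HilbertForm 2 (φ c) z = 0 ∧ k3HilbertForm 2 (φ c) (star z) = 0)) ∧
    (k3HilbertForm 2 z z = 0 ∧ 0 < (k3HilbertForm 2 (star z) z).re)))

/-- **Cell (3,5) of crux #5 `LowPicardRealMultiplication` on the `X` side, pointwise: HC⁴ of every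
marked smooth projective `K3^{[2]}`-type fourfold whose K3 partner is of the ζ₁₁ real-multiplication
type.** A marked smooth projective `K3^{[2]}`-type fourfold `(X, φ, P, z)` with a transcendental Hodge
isometry `g : H²(S) → H²(X)` (rational, type-preserving, a `q`-isometry on `T(S)` — clauses (g1), (g2),
(g5) of the route's partner datum) from a marked projective K3 surface `(S, η, p, x)` of the ζ₁₁ type (as
in `hodgeConjectureFor_square_of_zeta11Type`) satisfies `HodgeConjectureFor 4 X`:
`HC⁴(S × S)` by `hodgeConjectureFor_square_of_zeta11Type`, then support #2 `PartnerTransport`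
(`PartnerLattice.partnerTransport_explicit`: Beauville's marked Hilbert square, blow-up + surjective
descent, Witt extension, Markman's algebraic lift). For the van Geemen–Schütt members (`ρ(S) = 2`,
`E = ℚ(ζ₁₁ + ζ₁₁⁻¹)`, `[E:ℚ] = 5`) the partners `X` have `ρ(X) = 3`: cell `(3,5)`. CONDITIONAL on
{`Buskin2019_hodgeIsometry_algebraic`, `VanGeemenSchuett2025_OguisoZhang2011_zeta11_cycleOnOpenPeriodSet`,
`Beauville1983_hilbertSquare_markedIncidence`, `Beauville1983_hilbertSquare_blowupDiagonal_surjection`,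
`Markman2024_rationalHodgeIsometry_lift_algebraic_marked`, `Voisin2003_cupProduct_algebraicClasses`};
credits nothing; neither the crux nor HC is proved here.
[cite: GeemenSchutt2023, Thm. 1.1 (11), §4.8, §5.8] [cite: OguisoZhang2011K3Order11, Thm. 1.5 (3)]
[cite: Markman2024, §1.1 Thm. 1.1 and Thm. 1.4] [cite: Beauville1983, §6 (e)–(f), Prop. 6]
[cite: Buskin2019, Thm. 1.1] -/
theorem hodgeConjectureFor_of_zeta11Partner
    (hB : Buskin2019_hodgeIsometry_algebraic)
    (hV : VanGeemenSchuett2025_OguisoZhang2011_zeta11_cycleOnOpenPeriodSet)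
    (hBI : Beauville1983_hilbertSquare_markedIncidence)
    (hBea : Beauville1983_hilbertSquare_blowupDiagonal_surjection)
    (hMk : Markman2024_rationalHodgeIsometry_lift_algebraic_marked)
    (hcup : Voisin2003_cupProduct_algebraicClasses)
    {g : Module.End ℂ (K3Index → ℂ)} {u₁ u₂ : K3Index → ℤ} {y₀ : K3Index → ℂ}
    {θ : Matrix K3Index K3Index ℚ} (hZ : Zeta11Model[g, u₁, u₂, y₀, θ])
    {X : SchemeOver ℂ} (hX : IsSmoothProjective 4 X) (hK : IsOfK3HilbertSquareType X)
    {φ : complexBetti X 2 ≃ₗ[ℂ] (K3HilbertIndex → ℂ)} {PX : complexBetti X (2 * 4)}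
    {z : K3HilbertIndex → ℂ} (hMX : MarkedK3Sq[X, φ, PX, z])
    {S : SchemeOver ℂ} (hS : IsK3Surface S) {P : ℚ[X]} (hPsep : P.Separable) (hP0 : P.eval 0 ≠ 0)
    (η : complexBetti S (2 * 1) ≃ₗ[ℂ] (K3Index → ℂ)) (p : complexBetti S (2 * 2)) (x : K3Index → ℂ)
    (hM : MarkedK3[S, η, p, x])
    (t : complexBetti S (2 * 1) →ₗ[ℂ] complexBetti S (2 * 1))
    (ht_rat : ∀ y, IsRationalClass y → IsRationalClass (t y))
    (ht_typ : ∀ (i j : ℕ) (y : complexBetti S (2 * 1)),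
      IsOfHodgeType 2 S (2 * 1) i j y → IsOfHodgeType 2 S (2 * 1) i j (t y))
    (ht_N : ∀ d ∈ algebraicClasses S 1, t d = 0)
    (ht_perp : ∀ (y : complexBetti S (2 * 1)), ∀ d ∈ algebraicClasses S 1,
      cupProduct (rfl : 2 * 1 + 2 * 1 = 2 * 2) (t y) d = 0)
    (hP : IsAnnihilatedOnTranscendentalBy S t P) (hgen : TranscendentalEndomorphismsGeneratedBy S t)
    (σ : Module.End ℂ (K3Index → ℂ)) (hσ : ∀ a b, k3Form (σ a) (σ b) = k3Form a b)
    (hσrat : ∀ v : K3Index → ℤ, ∃ w : K3Index → ℚ, σ (fun i => (v i : ℂ)) = fun i => (w i : ℂ))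
    (hconj : ∀ c : complexBetti S (2 * 1), σ (η (t c)) = thetaC θ (σ (η c)))
    {gX : complexBetti S (2 * 1) →ₗ[ℂ] complexBetti X 2}
    (hg1 : ∀ a, IsRationalClass a → IsRationalClass (gX a))
    (hg2 : ∀ (i j : ℕ) a, IsOfHodgeType 2 S (2 * 1) i j a → IsOfHodgeType 4 X 2 i j (gX a))
    (hg5 : ∀ a b, (∀ d ∈ algebraicClasses S 1, cupProduct (rfl : 2 * 1 + 2 * 1 = 2 * 2) a d = 0) →
      (∀ d ∈ algebraicClasses S 1, cupProduct (rfl : 2 * 1 + 2 * 1 = 2 * 2) b d = 0) →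
      k3HilbertForm 2 (φ (gX a)) (φ (gX b)) = k3Form (η a) (η b)) :
    HodgeConjectureFor 4 X := by
  obtain ⟨hp0, hmk, hxx, hxpos, hu⟩ := hM
  exact PartnerLattice.partnerTransport_explicit hBI hBea hMk hcup hX hK hMX hS hmk hxx hxpos hu hg1 hg2 hg5
    (hodgeConjectureFor_square_of_zeta11Type hB hV hZ hS hPsep hP0 η p x ⟨hp0, hmk, hxx, hxpos, hu⟩ t
      ht_rat ht_typ ht_N ht_perp hP hgen σ hσ hσrat hconj)

end Summit.HodgeConjecture.HodgeConjecture.Theorems.MarkmanPartnerTransport.RMTypeOrbit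

end
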